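import Summits.BirchSwinnertonDyer.Rank1Residual.X11b.BDPRouteControlStrictPlace
import Summits.BirchSwinnertonDyer.Rank1Residual.X11b.BDPRouteLocalKernelAtPPadic
import Summits.BirchSwinnertonDyer.Rank1Residual.X11b.BDPRouteControlTamagawa
import HarnessLib

/-!
# Class X11b, route p2: (CTL≤)ᵗ WITHOUT the erratum's (iv) — the control input of the statement
# of record from ONE torsion-weighted Selmer bound `#Sel_𝔭(K, E[p^∞]) · #E(ℚ_p)[p^∞] ≤ p^a`
# (cell `b2b-bsdres`, sub-cell `multr1-p2`, gen 17)

HONEST FRAMING (verbatim, cell `b2b-bsdres`): the goal of the cell is to DELETE the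
COMBINATION-SHAPED residual classes for ALL analytic-rank `≤ 1` curves over `ℚ` — "full BSD
formula for every rank `≤ 1` curve in class `C`" assembled STRICTLY from published theorems — so
that the rank-`≤ 1` remainder becomes exactly the CONSTRUCTION-SHAPED classes, which are TYPED
(missing-input Props), NOT attempted; this is not "finishing BSD". Research route `p2` for class
X11b; no claim beyond the stated class; nothing booked; X11b stays CONSTRUCTION-SHAPED. Theorems
only; no definition; no named fact; no `sorry`. Continues `BDPRouteControlTamagawa` (gen 14),
`BDPRouteControlStrictPlace` and `BDPRouteLocalKernelAtP[Padic]` (gen 17).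

## Content

Gens 12–16 reduced route p2's control input (T1ᵗ-CTL≤) `P2ControlUpperOnTreeAt` (Cas18 Thm. 2.3
`≤`) to kernel theorems plus ONE Selmer bound, but ONLY under the erratum's hypothesis (iv)
`E(ℚ_p)[p] = 0`, used to kill the local kernel at the strict place `𝔭`. Here (iv) is dropped: the
kernel at `𝔭` is COUNTED (`#ker r_𝔭 ≤ #E(ℚ_p)[p^∞] = p^m`, `BDPRouteLocalKernelAtPPadic`) and the
Selmer bound is asked in the torsion-weighted form `#Sel_𝔭(K, E[p^∞]) · #E(ℚ_p)[p^∞] ≤ p^a` with the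
SAME exponent `a ≤ ord_p #Ш(E/K)[p^∞] + 2((ord_p log_ω P − 1) − ord_p[E(K):ℤP]) + ord_p ∏_{w∣p} c_w`
— which is what Cas18 (3.2.1)+(calcul) / JSW Prop. 3.2.1 give in general (the factor
`#H⁰(K_𝔭, E[p^∞])` of (calcul) lowers the Selmer count by exactly what the control kernel costs).

* `controlUpperOnTreeAt_of_selmerCardBound_torsion` — at a datum (quadratic totally complex `K`,
  anticyclotomic `κ`, generator `γ`, degree-one `𝔭 ∣ p`, `p ∣ N_E` split in `K`): (CTL≤)ᵗ from the
  torsion-weighted Selmer bound; NO (iv). Kernels at `Σ(N⁺)` by Greenberg Lemma 3.3 with the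
  Tamagawa bound (gen 14), at `𝔭` by Lemma 3.3 above `p` (gen 17), counting snake lemma with `𝔭`
  counted (gen 17), away descent (sibling).
* **`p2ControlUpperOnTreeAt_of_selmerCardBound_torsion`** — class level: `P2ControlUpperOnTreeAt W p`
  from the torsion-weighted Selmer bound at every p2 datum, NO (iv). With the gen-17 Selmer count
  this discharges the LAST typed algebraic input of `P2.bsdp_of_onTree_selmer_split` (the 3 771 ‖ 143
  X11b-shape pairs where (iv) fails).

CONDITIONAL (a hypothesis stated inline; nothing asserted); nothing booked; labels unchanged.

References: [Castella2018] Thm. 2.3 and its proof, (3.2.1), (calcul) (arXiv:1704.06608 pp. 5–6);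
[GreenbergLNM1716] §3 Lemma 3.3 (p. 87), p. 90; [JetchevSkinnerWan2017] Prop. 3.2.1, §3.3 (shape);
[Castella2018Erratum] Thm. 1.1 (iv) (the hypothesis dispensed with).
-/

noncomputable section

open scoped Classical

open NumberField IsDedekindDomain Field WeierstrassCurve
open Literature.NumberTheory.EllipticCurves Literature.NumberTheory.EllipticCurves.GreenbergSelmer
open Literature.NumberTheory.GaloisRepresentations
open Literature.NumberTheory.EllipticCurves.ModularForms
open Literature.NumberTheory.EllipticCurves.Rank1Residual
open Literature.NumberTheory.EllipticCurves.Rank1Residual.Typed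
open Literature.NumberTheory.EllipticCurves.Wuthrich2014
open Literature.NumberTheory.EllipticCurves.BalakrishnanEtAl2019
open Literature.NumberTheory.QuadraticFields.Quadratic
open Literature.NumberTheory.Automorphic

namespace Summit.BirchSwinnertonDyer.Rank1Residual.X11b

open AcSelmer

section Datum

variable {W : WeierstrassCurve ℚ} [W.IsElliptic] [W.IsGloballyMinimal] {K : Type} [Field K]
  [NumberField K] {p : ℕ} [Fact p.Prime] {κ : ZpExtension K p} {𝔭 : HeightOneSpectrum (𝓞 K)}
  {γ : Field.absoluteGaloisGroup K} [Fact (κ.IsTopGenerator γ)] {ι : K →+* ℚ_[p]}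

/-- **(CTL≤)ᵗ at a datum WITHOUT (iv), from ONE torsion-weighted Selmer bound.** For `E/ℚ` over a
quadratic totally complex `K`, an anticyclotomic `ℤ_p`-extension `κ` with generator `γ`, a degree-one
prime `𝔭 ∣ p` of `K`, `p ∣ N_E` split in `K`: if `Sel_𝔭(K, E[p^∞])` is finite with
`#Sel_𝔭(K, E[p^∞]) · #E(ℚ_p)[p^∞] ≤ p^a` and
`a ≤ ord_p #Ш(E/K)[p^∞] + 2((ord_p log_ω P − 1) − ord_p[E(K):ℤP]) + ord_p ∏_{w∣p} c_w(E/K)`, then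
`ControlUpperOnTreeAt p κ 𝔭 γ ι P`. The local kernels are theorems: `#ker r_v ≤ c_v^{(p)}` on
`Σ(N⁺)` (Greenberg Lemma 3.3, gen 14) and `#ker r_𝔭 ≤ #E(ℚ_p)[p^∞]` at the strict place (gen 17);
the counting snake lemma counts `𝔭` (gen 17); Tamagawa bookkeeping
`ord_p ∏_{w∣N⁺} c_w = ord_p ∏_{w∣p} c_w + Σ_{Σ(N⁺)} ord_p c_v` (sibling). NO hypothesis on
`E(K_𝔭)[p]`. [cite: Castella2018, Thm. 2.3 and its proof, (3.2.1) (arXiv:1704.06608 pp. 5–6)]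
[cite: GreenbergLNM1716, §3 Lemma 3.3 (p. 87), p. 90] -/
theorem controlUpperOnTreeAt_of_selmerCardBound_torsion [IsTotallyComplex K]
    (hK : Module.finrank ℚ K = 2) (hκ : κ.IsAnticyclotomic)
    (h𝔭 : ((p : ℕ) : 𝓞 K) ∈ 𝔭.asIdeal) (he : 𝔭.asIdeal.ramificationIdx (𝓞 ℚ) = 1)
    (hf : 𝔭.asIdeal.inertiaDeg (𝓞 ℚ) = 1)
    (hsplit : SplitsIn K p) (hpN : p ∣ W.conductorNorm ℤ)
    [Finite (selmerAcBase (W.baseChange K) p 𝔭 ∅)]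
    {a : ℕ} (ha : Nat.card (selmerAcBase (W.baseChange K) p 𝔭 ∅) *
      Nat.card (AddCommGroup.primaryComponent (W.baseChange ℚ_[p]).toAffine.Point p) ≤ p ^ a)
    {P : (W.baseChange K).toAffine.Point}
    (hm : (a : ℤ) ≤
      (padicValNat p (Nat.card (AddCommGroup.primaryComponent (W.baseChange K).sha p)) : ℤ) +
      2 * ((padicLogOrd W p ι P - 1) - (padicValNat p (AddSubgroup.zmultiples P).index : ℤ)) +
        padicValNat p (tamagawaProductAbove W K p)) :
    ControlUpperOnTreeAt p κ 𝔭 γ ι P := by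
  haveI hEK : (W.baseChange K).IsElliptic := by rw [baseChange]; infer_instance
  have hp : p.Prime := Fact.out
  -- `#E(ℚ_p)[p^∞] = p^m`, `#Sel ≤ p^(a - m)`, `m ≤ a`
  obtain ⟨m, hmcard⟩ := exists_natCard_primaryComponent_padic_eq_pow W p
  have hSelpos : 0 < Nat.card (selmerAcBase (W.baseChange K) p 𝔭 ∅) := Nat.card_pos
  have hma : m ≤ a := by
    have h1 : p ^ m ≤ p ^ a := by
      calc p ^ m = 1 * p ^ m := (one_mul _).symm
        _ ≤ Nat.card (selmerAcBase (W.baseChange K) p 𝔭 ∅) * p ^ m :=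
            Nat.mul_le_mul_right _ hSelpos
        _ ≤ p ^ a := by rw [← hmcard]; exact ha
    exact (Nat.pow_le_pow_iff_right hp.one_lt).mp h1
  have ha' : Nat.card (selmerAcBase (W.baseChange K) p 𝔭 ∅) ≤ p ^ (a - m) := by
    have h1 : Nat.card (selmerAcBase (W.baseChange K) p 𝔭 ∅) * p ^ m ≤ p ^ (a - m) * p ^ m := by
      rw [← pow_add, Nat.sub_add_cancel hma, ← hmcard]; exact ha
    exact Nat.le_of_mul_le_mul_right h1 (pow_pos hp.pos m)
  -- the finite set `T = Σ(N⁺) ∪ {𝔭}`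
  have hSp : ∀ v ∈ (nPlusPlaces_finite (W := W) (K := K) (p := p) hK).toFinset,
      ((p : ℕ) : 𝓞 K) ∉ v.asIdeal := fun v hv ↦
    (((nPlusPlaces_finite (W := W) (K := K) (p := p) hK).mem_toFinset).mp hv).1
  have h𝔭S : 𝔭 ∉ (nPlusPlaces_finite (W := W) (K := K) (p := p) hK).toFinset := fun h ↦ hSp 𝔭 h h𝔭
  -- the kernel bounds: `b 𝔭 = m`, `b v = ord_p c_v` on `Σ(N⁺)`
  let b : HeightOneSpectrum (𝓞 K) → ℕ := fun v ↦
    if v = 𝔭 then m else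
      padicValNat p (((W.baseChange K).baseChange (v.adicCompletion K)).localTamagawaNumber
        (v.adicCompletionIntegers K))
  have hb𝔭 : b 𝔭 = m := if_pos rfl
  have hbS : ∀ v ∈ (nPlusPlaces_finite (W := W) (K := K) (p := p) hK).toFinset,
      b v = padicValNat p (((W.baseChange K).baseChange
        (v.adicCompletion K)).localTamagawaNumber (v.adicCompletionIntegers K)) := fun v hv ↦
    if_neg (ne_of_mem_of_not_mem hv h𝔭S)
  have hsum : a - m + ∑ v ∈ insert 𝔭 (nPlusPlaces_finite (W := W) (K := K) (p := p) hK).toFinset, b v =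
      a + ∑ v ∈ (nPlusPlaces_finite (W := W) (K := K) (p := p) hK).toFinset,
        padicValNat p (((W.baseChange K).baseChange (v.adicCompletion K)).localTamagawaNumber
          (v.adicCompletionIntegers K)) := by
    rw [Finset.sum_insert h𝔭S, hb𝔭, Finset.sum_congr rfl hbS, ← add_assoc, Nat.sub_add_cancel hma]
  obtain ⟨hfin𝔭, hle𝔭⟩ := natCard_localKer_le_natCard_primaryComponent_padic W p κ 𝔭 h𝔭 he hf
  refine controlUpperOnTreeAt_of_localKer_bounds_strict
    (insert 𝔭 (nPlusPlaces_finite (W := W) (K := K) (p := p) hK).toFinset)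
    (Finset.mem_insert_self 𝔭 _)
    (fun v hv hv𝔭 ↦ hSp v ((Finset.mem_insert.mp hv).resolve_left hv𝔭))
    (fun c hc v hv _ hvT ↦ away_descent_of_splitBad_subset (W.baseChange K) p κ 𝔭
      (↑(insert 𝔭 (nPlusPlaces_finite (W := W) (K := K) (p := p) hK).toFinset) :
        Set (HeightOneSpectrum (𝓞 K))) hK hκ
      (fun v' hpv hbad he' hf' ↦ Finset.mem_coe.mpr (Finset.mem_insert_of_mem
        (((nPlusPlaces_finite (W := W) (K := K) (p := p) hK).mem_toFinset).mpr
          (mem_nPlusPlaces_of v' hpv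
            (primesEquiv_under_dvd_conductorNorm_of_not_hasGoodReductionAt K v' hbad) he' hf'))))
      c (selmerAc_empty_le hc) v hv (fun h ↦ hvT (Finset.mem_coe.mp h)))
    (fun v hv ↦ ?_) ha' (b := b) (fun v hv ↦ ?_) ?_
  · -- finiteness of the kernels on `T`
    rcases Finset.mem_insert.mp hv with rfl | hvS
    · exact hfin𝔭
    · exact (natCard_localKer_le_pow_padicValNat_localTamagawaNumber (W.baseChange K) κ
        (hSp v hvS)).1
  · -- the bounds on `T`
    rcases Finset.mem_insert.mp hv with rfl | hvS
    · rw [hb𝔭, ← hmcard]; exact hle𝔭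
    · rw [hbS v hvS]
      exact (natCard_localKer_le_pow_padicValNat_localTamagawaNumber (W.baseChange K) κ
        (hSp v hvS)).2
  · -- the arithmetic
    rw [hsum, padicValNat_tamagawaProductSplit_eq_above_add_sum W p hK hsplit hpN, Nat.cast_add,
      Nat.cast_add]
    linarith

end Datum

/-! ## Class level: `P2ControlUpperOnTreeAt` WITHOUT (iv) from one torsion-weighted Selmer bound per datum -/

section ClassLevel

variable {W : WeierstrassCurve ℚ} [W.IsElliptic] [W.IsGloballyMinimal] {p : ℕ} [Fact p.Prime]

/-- **The typed input (T1ᵗ-CTL≤) of the statement of record WITHOUT (iv), from ONE torsion-weighted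
Selmer bound per datum.** `P2ControlUpperOnTreeAt W p` (Cas18 Thm. 2.3 `≤`, PUB shape) follows
from: at every p2 datum (Heegner field `K`, anticyclotomic `κ`, generator `γ`, degree-one `𝔭 ∣ p`,
non-torsion `P`), finiteness of `Sel_𝔭(K, E[p^∞])` with `#Sel_𝔭(K, E[p^∞]) · #E(ℚ_p)[p^∞] ≤ p^a`,
`a ≤ ord_p #Ш(E/K)[p^∞] + 2((ord_p log_ω P − 1) − ord_p[E(K):ℤP]) + ord_p ∏_{w∣p} c_w(E/K)` — Cas18
(3.2.1)+(calcul) in `≤` form with its `#H⁰(K_𝔭, E[p^∞])`-factor kept (JSW Prop. 3.2.1). All local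
kernels of the control diagram, INCLUDING the strict place's, are kernel theorems; NO hypothesis
`E(ℚ_p)[p] = 0`. The Selmer bound is a HYPOTHESIS here (stated inline; nothing asserted) — proved
in `BDPRouteSelmerCardBoundTorsion`. CONDITIONAL; nothing booked.
[cite: Castella2018, Thm. 2.3 and its proof, (3.2.1), (calcul) (arXiv:1704.06608 pp. 5–6)]
[cite: JetchevSkinnerWan2017, Prop. 3.2.1 (shape only)] [cite: GreenbergLNM1716, §3 Lemma 3.3 (p. 87), p. 90] -/
theorem p2ControlUpperOnTreeAt_of_selmerCardBound_torsion
    (hsel : ∀ (N : ℕ) [NeZero N] (K : Type) [Field K] [NumberField K]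
      (Dt : ModularParametrizationData W N) (H : HeegnerDatum N (NumberField.discr K)) (ι : K →+* ℂ)
      (P : (W.baseChange K).toAffine.Point),
      ClassX11b W p → 5 ≤ p → Surj W p → W.conductorNorm ℤ = N → IsImaginaryQuadratic K →
      Odd (NumberField.discr K) → ¬ (p : ℤ) ∣ NumberField.discr K → ¬ p ∣ Units.torsionOrder K →
      SatisfiesHeegnerHypothesis N K →
      (W.quadraticTwist (NumberField.discr K : ℚ)).entireLFunction 1 ≠ 0 →
      WeierstrassCurve.Affine.Point.map ι.toRatAlgHom P = heegnerPointComplex Dt H →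
      ¬ (p : ℤ) ∣ Dt.c → ¬ IsOfFinAddOrder P →
      ∀ (κ : ZpExtension K p), κ.IsAnticyclotomic →
        ∀ (γ : Field.absoluteGaloisGroup K) [Fact (κ.IsTopGenerator γ)]
          (𝔭 : HeightOneSpectrum (𝓞 K)) (h𝔭 : ((p : ℕ) : 𝓞 K) ∈ 𝔭.asIdeal)
          (he : 𝔭.asIdeal.ramificationIdx (𝓞 ℚ) = 1) (hf : 𝔭.asIdeal.inertiaDeg (𝓞 ℚ) = 1),
          ∃ (_ : Finite (selmerAcBase (W.baseChange K) p 𝔭 ∅)) (a : ℕ),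
            Nat.card (selmerAcBase (W.baseChange K) p 𝔭 ∅) *
                Nat.card (AddCommGroup.primaryComponent (W.baseChange ℚ_[p]).toAffine.Point p) ≤
              p ^ a ∧
            (a : ℤ) ≤
              (padicValNat p (Nat.card (AddCommGroup.primaryComponent (W.baseChange K).sha p)) : ℤ) +
              2 * ((padicLogOrd W p (embAt K p 𝔭 h𝔭 he hf) P - 1) -
                (padicValNat p (AddSubgroup.zmultiples P).index : ℤ)) +
                padicValNat p (tamagawaProductAbove W K p)) :
    P2ControlUpperOnTreeAt W p := by
  intro N _ K _ _ Dt H ι P hX hp5 hs hN hK hodd hpd hμ hHN hLt hP hc hPinf κ hκ γ _ 𝔭 h𝔭 he hf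
  haveI : IsTotallyComplex K := hK.2
  obtain ⟨-, -, hmult, -⟩ := id hX
  have hpN : p ∣ W.conductorNorm ℤ := dvd_conductorNorm_of_mult hmult
  have hsplit : SplitsIn K p := hHN p Fact.out (hN ▸ hpN)
  obtain ⟨hfinK, a, ha, hm⟩ :=
    hsel N K Dt H ι P hX hp5 hs hN hK hodd hpd hμ hHN hLt hP hc hPinf κ hκ γ 𝔭 h𝔭 he hf
  haveI := hfinK
  exact controlUpperOnTreeAt_of_selmerCardBound_torsion hK.1 hκ h𝔭 he hf hsplit hpN ha hm

end ClassLevel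

end Summit.BirchSwinnertonDyer.Rank1Residual.X11b

end
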